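import Literature.Barriers.CriticalPhenomena.LaceExpansionIsingDeconvolutionAssembly
import Literature.Barriers.CriticalPhenomena.LaceExpansionGaussianLemmaProofs
import Literature.Barriers.CriticalPhenomena.LaceExpansionIsingAboveFourNNDischarge
import HarnessLib

/-!
# `S_1(x)|x|^{d-2} → a_d/σ²` for Sakai's spread-out walk from Hara's Gaussian lemma, and the
# barrier `LaceExpansionIsingAboveFour` reduced to three named facts

Barrier catalogue `Literature/Barriers/CriticalPhenomena/` (D-0021). In the assembly of
Liu–Slade's Theorem 1.7 (`LaceExpansionIsingDeconvolutionAssembly.lean`,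
`LiuSlade2026_thm1_7_of_parts`) two of the six named inputs — Liu–Slade 2026, Prop. 1.2 (1.9)
(`LiuSlade2026_prop12_asymp`: `S_1 = δ + C_1/σ² + O(L^{-1+ε}⟦x⟧^{1-d})`) and the asymptotics (1.8)
of the nearest-neighbour Green function (`srwGreen_asymp`: `C_1(x) = a_d⟦x⟧^{2-d} + O(⟦x⟧^{-d})`) —
enter ONLY through the limit

`S_1(x)|x|^{d-2} → a_d/σ²` (`|x| → ∞`, each fixed `L`),

the step "`S_1(x) ∼ σ^{-2}C_1(x) ∼ σ^{-2}a_d/|x|^{d-2}`" of (2.20) (`tendsto_soGreen_one_mul_rpow`).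
This file PROVES that limit for every `d ≥ 3`, `L ≥ 1` (`tendsto_soGreen_one_mul_rpow_holds`),
directly from **Hara's Gaussian lemma** — Hara 2008, Thm. 1.3, a theorem of the tree
(`Hara2008_thm13_holds`, `LaceExpansionGaussianLemmaProofs.lean`): for a `ℤ^d`-symmetric kernel
`J` with `Σ J = 1`, the infrared bound `1 - Ĵ(k) ≥ K₀|k|²/(2d)`, `K₁ = Σ|x|²J(x) > 0` and enough
moments/decay, `C(x) = ∫_{[-π,π]^d} e^{ik·x}/(1 - Ĵ(k)) dk/(2π)^d = (a_d/K₁)|x|^{2-d} +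
O(|x|^{-(d-2+(ρ∧2)/d)})` — applied to `J = D`, the step distribution of Sakai's spread-out walk:

* Part 1, `haraKernelHyp_soStep`: `D` satisfies (1.18)–(1.19') for every `L ≥ 1`, `ρ > 0`
  (`K₀ = 1/(8π²)` from the uniform infrared bound `infrared_lower_bound` of
  `LaceExpansionIsingGreenUniform.lean`; `K₁ = σ²`; finite range);
* Part 2, `re_haraC_soStep`: `Re C(x) = S_1(x)` (`1 - D̂` is real, `one_sub_latticeFT_eq_ofReal`;
  `Re ∫ = ∫ Re`; the Fourier representation `soGreen_eq_integral` of `S_1 = Σ_n D^{*n}`);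
* Part 3, `tendsto_soGreen_one_mul_rpow_holds`: `|S_1(x)|x|^{d-2} - a_d/σ²| ≤ K|x|^{-2/d} → 0`;
* Part 4, the assembly re-run without the two inputs: `LiuSlade2026_thm1_7_of_parts'`
  (Thm. 2.2, infrared bound, Prop. 4.1, Liu–Slade 2024 Thm. 1.2 ⇒ Thm. 1.7; the threshold
  bookkeeping of `LiuSlade2026_thm1_7_of_parts` verbatim), `LiuSlade2026_thm1_7_of_two_facts`,
  `Sakai2007_thm13_spreadOut_of_three_analysis_facts`, and — both bubble-condition conjuncts being
  theorems (`NNIsing.bubble_susceptibility_upper_holds`; `bubble_susceptibility_upper_of_aizenmanGraham`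
  with `aizenmanGraham_inequality_holds` on the range-`L` graph, cf.
  `LaceExpansionIsingAboveFourSODischarge.lean`) — **`LaceExpansionIsingAboveFour_of_three_facts`**:

  `LiuSlade2026_thm22 → LiuSlade2024_thm12_critical → Sakai2007_isingAssumptionH → LaceExpansionIsingAboveFour`.

So the trust base of the barrier is down to three named facts: two theorems of pure Fourier
analysis (Liu–Slade's Gaussian deconvolution theorems) and the lace expansion proper (Sakai 2007,
Props. 1.1 and 3.1, with Sakai 2022). The named facts `LiuSlade2026_prop12_asymp` and
`srwGreen_asymp` stay in the tree as cited statements; they are no longer on this barrier's path.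

## References

* T. Hara, *Decay of correlations in nearest-neighbor self-avoiding walk, percolation, lattice
  trees and animals*, Ann. Probab. 36 (2008) 530–593 (arXiv:math-ph/0504021): Thm. 1.3
  ((1.18)–(1.20a)), §1.2.2 [Hara2008].
* Y. Liu, G. Slade, *Gaussian deconvolution and the lace expansion for spread-out models*,
  Ann. Inst. H. Poincaré Probab. Statist. (2026), arXiv:2310.07640: §1.2.1 ((1.6)–(1.9)),
  Thm. 1.7, §1.3, §2.2 ((2.18)–(2.20)) [LiuSlade2026].
* Y. Liu, G. Slade, *Gaussian deconvolution and the lace expansion*, Probab. Theory Related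
  Fields (2024), arXiv:2310.07635: Thm. 1.2 [LiuSlade2024].
* A. Sakai, *Lace expansion for the Ising model*, Comm. Math. Phys. 272 (2007) 283–344
  (arXiv:math-ph/0510093): Thm. 1.3, (1.19) [Sakai2007].
-/

noncomputable section

namespace Literature.Barriers.CriticalPhenomena.SpreadOutIsing

open Filter Literature.Probability.LatticeModels Literature.Probability.Percolation
open _root_.MeasureTheory _root_.Topology
open scoped BigOperators

variable {d L : ℕ}

/-! ## Part 1. Sakai's step distribution satisfies the hypotheses of Hara's Theorem 1.3 -/

/-- On the cube `[-π,π]^d`: `‖k‖_∞ ≤ π`. [folklore] -/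
theorem norm_le_pi_of_mem_cube {k : Fin d → ℝ} (hk : k ∈ cube d) : ‖k‖ ≤ Real.pi := by
  refine (pi_norm_le_iff_of_nonneg Real.pi_pos.le).2 fun i => ?_
  have h := hk i (Set.mem_univ _)
  rw [Real.norm_eq_abs]
  exact abs_le.2 ⟨h.1, h.2⟩

/-- **Hara's infrared hypothesis (1.18) for `D`**: `1 - D̂(k) ≥ K₀|k|²/(2d)` on `[-π,π]^d` with
`K₀ = 1/(8π²)`, from the uniform infrared bound `1 - D̂(k) ≥ (1/16) min{L²‖k‖_∞², 1}`
(`infrared_lower_bound`) and `min{L²‖k‖_∞², 1} ≥ ‖k‖_∞²/π² ≥ |k|²/(dπ²)` on the cube.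
[cite: Hara2008, Thm. 1.3, hypothesis (1.18)] -/
theorem hara_lower_soStep (hd : 1 ≤ d) (hL : 1 ≤ L) {k : Fin d → ℝ} (hk : k ∈ cube d) :
    1 / (8 * Real.pi ^ 2) * (∑ i, k i ^ 2) / (2 * d) ≤ 1 - (latticeFT (soStep d L) k).re := by
  rw [soSymbol_eq_re_latticeFT]
  have hIR := infrared_lower_bound hd hL hk
  have hd0 : (0 : ℝ) < d := by exact_mod_cast hd
  have hπ : ‖k‖ ≤ Real.pi := norm_le_pi_of_mem_cube hk
  have hπ1 : (1 : ℝ) ≤ Real.pi ^ 2 := by nlinarith [Real.pi_gt_three]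
  have hπ0 : (0 : ℝ) < Real.pi ^ 2 := by positivity
  have hL1 : (1 : ℝ) ≤ (L : ℝ) ^ 2 := one_le_pow₀ (by exact_mod_cast hL)
  have hk0 : 0 ≤ ‖k‖ ^ 2 := sq_nonneg _
  -- `‖k‖²/π² ≤ min (L²‖k‖²) 1`
  have hmin : ‖k‖ ^ 2 / Real.pi ^ 2 ≤ min ((L : ℝ) ^ 2 * ‖k‖ ^ 2) 1 := by
    refine le_min ?_ ?_
    · calc ‖k‖ ^ 2 / Real.pi ^ 2 ≤ ‖k‖ ^ 2 := div_le_self hk0 hπ1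
        _ ≤ (L : ℝ) ^ 2 * ‖k‖ ^ 2 := le_mul_of_one_le_left hk0 hL1
    · rw [div_le_one hπ0]
      exact pow_le_pow_left₀ (norm_nonneg _) hπ 2
  have hsum := sum_sq_le_card_mul_norm_sq k
  calc 1 / (8 * Real.pi ^ 2) * (∑ i, k i ^ 2) / (2 * d)
      ≤ 1 / (8 * Real.pi ^ 2) * (d * ‖k‖ ^ 2) / (2 * d) := by gcongr
    _ = 1 / 16 * (‖k‖ ^ 2 / Real.pi ^ 2) := by field_simp; ring
    _ ≤ 1 / 16 * min ((L : ℝ) ^ 2 * ‖k‖ ^ 2) 1 := by gcongr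
    _ ≤ 1 - soSymbol d L k := hIR

/-- `Σ_x |x|^s |D(x)| < ∞` for every real `s` (finite range). [folklore] -/
theorem summable_rpow_mul_abs_soStep (s : ℝ) :
    Summable fun x : Site d => euclidNorm x ^ s * |soStep d L x| :=
  summable_of_ne_finset_zero (s := (spreadOutGraph d L).neighborFinset 0) fun x hx => by
    rw [soStep_of_not_adj fun h => hx ((SimpleGraph.mem_neighborFinset _ _ _).2 h), abs_zero,
      mul_zero]

/-- `Σ_x |x|² D(x) = σ²` as a `tsum` (Hara's `K₁` for `J = D`). [cite: Hara2008, Thm. 1.3 (K₁ := Σ_x |x|²J(x))] -/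
theorem tsum_sq_mul_soStep : ∑' x : Site d, euclidNorm x ^ 2 * soStep d L x = soVariance d L :=
  hasSum_sq_mul_soStep.tsum_eq

/-- **Sakai's step distribution `D` obeys the hypotheses (1.18)–(1.19') of Hara's Theorem 1.3**
for every `d, L ≥ 1` and every `ρ > 0`: `D` is `ℤ^d`-symmetric with `Σ D = 1`, satisfies the
infrared bound with `K₀ = 1/(8π²)`, has `K₁ = σ² > 0`, and — having finite range — finite moments
and polynomial decay of every order (with `L`-dependent constants). [cite: Hara2008, Thm. 1.3 ((1.18)–(1.19'))] -/
theorem haraKernelHyp_soStep (hd : 1 ≤ d) (hL : 1 ≤ L) {ρ : ℝ} (hρ : 0 < ρ) :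
    HaraKernelHyp d (soStep d L) ρ where
  symm := isZdSymmetric_soStep
  rho_pos := hρ
  hasSum_one := hasSum_soStep hd hL
  lower := ⟨1 / (8 * Real.pi ^ 2), by positivity, fun k hk => hara_lower_soStep hd hL hk⟩
  secondMoment_pos := by rw [tsum_sq_mul_soStep]; exact soVariance_pos hd hL
  summable_sq := by simpa using summable_rpow_mul_abs_soStep (d := d) (L := L) 2
  decay := by
    obtain ⟨K, -, hK⟩ := exists_soStep_le_div_jnorm d L ((d : ℝ) + 2)
    exact ⟨K, hK⟩
  summable_rho := summable_rpow_mul_abs_soStep (2 + ρ)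
  decay_rho := by
    obtain ⟨K, -, hK⟩ := exists_soStep_le_div_jnorm d L ((d : ℝ) + 2 + ρ)
    exact ⟨K, hK⟩

/-! ## Part 2. Hara's `C(x)` for `J = D` is the Green function `S_1(x)` -/

/-- The integrand of Hara's `C(x)` for `J = D`: `e^{ik·x}/(1 - D̂(k)) = e^{ik·x}/(1 - D̂(k))` with the
REAL denominator `1 - D̂(k) = 1 - soSymbol d L k`. [folklore] -/
theorem haraC_integrand_soStep (x : Site d) (k : Fin d → ℝ) :
    Complex.exp (Complex.I * (kdot k x : ℂ)) / (1 - latticeFT (soStep d L) k) =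
      Complex.exp (Complex.I * (kdot k x : ℂ)) / ((1 - soSymbol d L k : ℝ) : ℂ) := by
  rw [one_sub_latticeFT_eq_ofReal summable_abs_soStep soStep_neg k, soSymbol_eq_re_latticeFT]

/-- Its real part is `cos(k·x)/(1 - D̂(k))`. [folklore] -/
theorem re_haraC_integrand_soStep (x : Site d) (k : Fin d → ℝ) :
    (Complex.exp (Complex.I * (kdot k x : ℂ)) / (1 - latticeFT (soStep d L) k)).re =
      Real.cos (kdot k x) / (1 - soSymbol d L k) := by
  rw [haraC_integrand_soStep, Complex.div_ofReal_re, mul_comm Complex.I, Complex.exp_ofReal_mul_I_re]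

/-- The integrand of `C(x)` is integrable on the cube (`d ≥ 3`): a bounded continuous factor times
the integrable `(1 - D̂)⁻¹` (`integrableOn_inv_one_sub_latticeFT` with the infrared bound of Part 1).
[cite: Hara2008, §2.1 (integrability of (1 - Ĵ)⁻¹ by (1.18))] -/
theorem integrableOn_haraC_integrand_soStep (hd : 3 ≤ d) (hL : 1 ≤ L) (x : Site d) :
    IntegrableOn (fun k => Complex.exp (Complex.I * (kdot k x : ℂ)) / (1 - latticeFT (soStep d L) k))
      (cube d) := by
  have hd1 : 1 ≤ d := by omega
  have hinv := integrableOn_inv_one_sub_latticeFT hd summable_abs_soStep soStep_neg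
    (by positivity : (0 : ℝ) < 1 / (8 * Real.pi ^ 2)) (fun k hk => hara_lower_soStep hd1 hL hk)
  simp_rw [div_eq_mul_inv]
  refine Integrable.bdd_mul (c := 1) hinv ?_ (ae_of_all _ fun k => ?_)
  · exact (Complex.continuous_exp.comp (continuous_const.mul
      (Complex.continuous_ofReal.comp (continuous_kdot_left x)))).aestronglyMeasurable
  · rw [Complex.norm_exp]
    simp

/-- **`C(x) = S_1(x)`** for `J = D`, on real parts: the real part of Hara's Bochner integral
`C(x) = ∫_{[-π,π]^d} e^{ik·x}/(1 - D̂(k)) dk/(2π)^d` is the Green function `S_1(x) = Σ_n D^{*n}(x)`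
(`soGreen_eq_integral`: `S_1(x) = (2π)^{-d}∫ cos(k·x)/(1 - D̂(k)) dk`, `d ≥ 3`).
[cite: Hara2008, §1.2.2 (C(x) for J = D is the random-walk Green function)]
[cite: LiuSlade2026, §1.2.1, (1.6)–(1.7)] -/
theorem re_haraC_soStep (hd : 3 ≤ d) (hL : 1 ≤ L) (x : Site d) :
    (haraC (soStep d L) x).re = soGreen d L 1 x := by
  have hint := integrableOn_haraC_integrand_soStep hd hL x
  have h2π : ((2 * Real.pi : ℂ)) ^ d = (((2 * Real.pi) ^ d : ℝ) : ℂ) := by push_cast; ring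
  rw [haraC, h2π, Complex.div_ofReal_re]
  have hre : (∫ k in cube d, Complex.exp (Complex.I * (kdot k x : ℂ)) /
      (1 - latticeFT (soStep d L) k)).re =
      ∫ k in cube d, Real.cos (kdot k x) / (1 - soSymbol d L k) := by
    rw [← RCLike.re_to_complex, ← integral_re hint]
    refine integral_congr_ae (ae_of_all _ fun k => ?_)
    simp only [RCLike.re_to_complex, re_haraC_integrand_soStep]
  rw [hre, soGreen_eq_integral hd hL zero_le_one le_rfl x]
  simp only [one_mul]
  rw [div_eq_inv_mul]

/-! ## Part 3. The Gaussian asymptotics of `S_1` -/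

/-- **`S_1(x)|x|^{d-2} → a_d/σ²` for EVERY `L ≥ 1`** (`d ≥ 3`): Hara's Gaussian lemma (Hara 2008,
Thm. 1.3, proved in the tree as `Hara2008_thm13_holds`) applied to `J = D` with `ρ = 2` gives
`S_1(x) = (a_d/σ²)|x|^{2-d} + O(|x|^{-(d-2+2/d)})`, in particular the limit. This is the input
"`S_1(x) ∼ σ^{-2}a_d/|x|^{d-2}`" of Liu–Slade's (2.20), there obtained from their (1.8)–(1.9)
(Prop. 1.2 and the asymptotics of the nearest-neighbour Green function); here it holds at each
fixed `L`, which is all the proof of Theorem 1.7 uses. [cite: Hara2008, Thm. 1.3 (1.20a)]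
[cite: LiuSlade2026, (2.20) (S_1(x) ∼ σ^{-2} a_d |x|^{2-d})] -/
theorem tendsto_soGreen_one_mul_rpow_holds (hd : 3 ≤ d) (hL : 1 ≤ L) :
    Tendsto (fun x : Site d => soGreen d L 1 x * euclidNorm x ^ ((d : ℝ) - 2)) cofinite
      (𝓝 (gaussianAmp d / soVariance d L)) := by
  have hd1 : 1 ≤ d := by omega
  have hd0 : (0 : ℝ) < d := by exact_mod_cast (show 0 < d by omega)
  obtain ⟨K, R, hKR⟩ := Hara2008_thm13_holds d hd (soStep d L) 2 (haraKernelHyp_soStep hd1 hL two_pos)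
  rw [tsum_sq_mul_soStep] at hKR
  set c : ℝ := gaussianAmp d / soVariance d L with hc
  set e : ℝ := min (2 : ℝ) 2 / d with he
  have he0 : 0 < e := by rw [he, min_self]; positivity
  -- the pointwise bound for `|x| ≥ max R 1`
  have hbound : ∀ x : Site d, max R 1 ≤ euclidNorm x →
      ‖soGreen d L 1 x * euclidNorm x ^ ((d : ℝ) - 2) - c‖ ≤ K * euclidNorm x ^ (-e) := by
    intro x hx
    have hR : R ≤ euclidNorm x := (le_max_left _ _).trans hx
    have h1 : 1 ≤ euclidNorm x := (le_max_right _ _).trans hx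
    have hpos : 0 < euclidNorm x := lt_of_lt_of_le one_pos h1
    have h := hKR x hR
    -- pass to real parts
    have hreal : |soGreen d L 1 x - c * euclidNorm x ^ (2 - (d : ℝ))| ≤
        K * euclidNorm x ^ (-((d : ℝ) - 2 + e)) := by
      refine le_trans ?_ h
      have := Complex.abs_re_le_norm (haraC (soStep d L) x - ((c * euclidNorm x ^ (2 - (d : ℝ)) : ℝ) : ℂ))
      rwa [Complex.sub_re, Complex.ofReal_re, re_haraC_soStep hd hL x] at this
    -- multiply by `|x|^{d-2}`
    have hmul : |soGreen d L 1 x - c * euclidNorm x ^ (2 - (d : ℝ))| * euclidNorm x ^ ((d : ℝ) - 2) ≤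
        K * euclidNorm x ^ (-((d : ℝ) - 2 + e)) * euclidNorm x ^ ((d : ℝ) - 2) :=
      mul_le_mul_of_nonneg_right hreal (Real.rpow_nonneg hpos.le _)
    have hprod1 : euclidNorm x ^ (2 - (d : ℝ)) * euclidNorm x ^ ((d : ℝ) - 2) = 1 := by
      rw [← Real.rpow_add hpos]; norm_num
    have hprod2 : euclidNorm x ^ (-((d : ℝ) - 2 + e)) * euclidNorm x ^ ((d : ℝ) - 2) =
        euclidNorm x ^ (-e) := by
      rw [← Real.rpow_add hpos]; ring_nf
    rw [Real.norm_eq_abs]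
    calc |soGreen d L 1 x * euclidNorm x ^ ((d : ℝ) - 2) - c|
        = |soGreen d L 1 x - c * euclidNorm x ^ (2 - (d : ℝ))| * euclidNorm x ^ ((d : ℝ) - 2) := by
          rw [← abs_of_pos (Real.rpow_pos_of_pos hpos ((d : ℝ) - 2)), ← abs_mul]
          congr 1
          rw [sub_mul, mul_assoc, hprod1, mul_one, abs_of_pos (Real.rpow_pos_of_pos hpos _)]
      _ ≤ K * euclidNorm x ^ (-((d : ℝ) - 2 + e)) * euclidNorm x ^ ((d : ℝ) - 2) := hmul
      _ = K * euclidNorm x ^ (-e) := by rw [mul_assoc, hprod2]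
  -- the majorant tends to `0` along the cofinite filter
  have hlim : Tendsto (fun x : Site d => K * euclidNorm x ^ (-e)) cofinite (𝓝 0) := by
    have h := ((tendsto_rpow_neg_atTop he0).comp (tendsto_euclidNorm_cofinite d)).const_mul K
    rw [mul_zero] at h
    exact h
  have hev : ∀ᶠ x : Site d in cofinite,
      ‖soGreen d L 1 x * euclidNorm x ^ ((d : ℝ) - 2) - c‖ ≤ K * euclidNorm x ^ (-e) := by
    filter_upwards [(tendsto_euclidNorm_cofinite d).eventually_ge_atTop (max R 1)] with x hx
    exact hbound x hx
  have h0 := squeeze_zero_norm' hev hlim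
  exact tendsto_sub_nhds_zero_iff.1 h0

/-! ## Part 4. The assembly: Theorem 1.7, Sakai's Theorem 1.3 and the barrier from the remaining
named facts -/

/-- **Liu–Slade 2026, Theorem 1.7 (corrected transcription `LiuSlade2026_thm1_7`) from Theorem 2.2,
the infrared bound (2.3), Proposition 4.1 and Liu–Slade 2024, Thm. 1.2** — the primed twin of
`LiuSlade2026_thm1_7_of_parts` (`LaceExpansionIsingDeconvolutionAssembly.lean`) in which the two
inputs Prop. 1.2 (1.9) (`LiuSlade2026_prop12_asymp`) and the nearest-neighbour asymptotics (1.8)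
(`srwGreen_asymp`) are no longer hypotheses: they entered that proof only through
`S_1(x)|x|^{d-2} → a_d/σ²` (`tendsto_soGreen_one_mul_rpow`), which Part 3 proves for every `L ≥ 1`
from Hara's Gaussian lemma. The threshold bookkeeping (`ε₀ = 1`, the choice of `L₂`) is that of
`LiuSlade2026_thm1_7_of_parts`, verbatim. [cite: LiuSlade2026, Theorem 1.7 and its proof (§2.2); §1.3]
[cite: Hara2008, Thm. 1.3] -/
theorem LiuSlade2026_thm1_7_of_parts' (h22 : LiuSlade2026_thm22) (hIRf : LiuSlade2026_infraredBound)
    (h41 : LiuSlade2026_prop41) (h24 : LiuSlade2024_thm12_critical) : LiuSlade2026_thm1_7 := by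
  intro d hd ρ hρ
  have hρ0 : 0 < ρ := lt_of_le_of_lt (le_max_right _ _) hρ
  have hd1 : 1 ≤ d := by omega
  have hd2' : 2 < d := by omega
  obtain ⟨βs₂, hβs₂, c, hc, C₂, L₀₂, H22⟩ := h22 d hd2' ρ hρ
  obtain ⟨βsI, hβsI, K_I, hKI, L₀I, HIR⟩ := hIRf d hd1 ρ hρ
  obtain ⟨K, hK, HE⟩ := exists_lsLambda_estimates d hd1 hρ0
  obtain ⟨βs₄, hβs₄, C₄, hC₄, H4⟩ := exists_impulse_of_assumptionH h41 hd1 hρ0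
  -- `S_1(x)|x|^{d-2} → a_d/σ²` at every level `L ≥ 1` (Part 3), in the shape used below
  obtain ⟨L₀₉, HS1⟩ : ∃ L₀ : ℕ, ∀ L : ℕ, L₀ ≤ L → 1 ≤ L →
      Tendsto (fun x : Site d => soGreen d L 1 x * euclidNorm x ^ ((d : ℝ) - 2)) cofinite
        (𝓝 (gaussianAmp d / soVariance d L)) :=
    ⟨0, fun L _ hL1 => tendsto_soGreen_one_mul_rpow_holds (by omega) hL1⟩
  refine ⟨1, one_pos, ?_⟩
  intro ε hε hε1 K_S hKS hSx G zc K_h η hη hGHx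
  obtain ⟨L₀S, hS⟩ := hSx
  obtain ⟨L₁, hGH⟩ := hGHx
  have hA0 : 0 ≤ C₄ * |K_h| := by positivity
  -- the `L`-dependent small quantities tend to `0`
  have hu : Tendsto (fun L : ℕ => (L : ℝ) ^ (-(2 - ε))) atTop (𝓝 0) :=
    (tendsto_rpow_neg_atTop (by linarith : (0 : ℝ) < 2 - ε)).comp tendsto_natCast_atTop_atTop
  have hv : Tendsto (fun L : ℕ => (L : ℝ) ^ (-c)) atTop (𝓝 0) :=
    (tendsto_rpow_neg_atTop hc).comp tendsto_natCast_atTop_atTop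
  have hηabs : Tendsto (fun L : ℕ => |η L|) atTop (𝓝 0) := by simpa using hη.abs
  have e1 : ∀ᶠ L : ℕ in atTop, |η L| < 1 := hηabs.eventually_lt_const one_pos
  have e2 : ∀ᶠ L : ℕ in atTop, |K_h| * (L : ℝ) ^ (-(2 - ε)) < βs₄ := by
    have h := hu.const_mul |K_h|
    rw [mul_zero] at h
    exact h.eventually_lt_const hβs₄
  have e3 : ∀ᶠ L : ℕ in atTop, C₄ * |K_h| * (L : ℝ) ^ (-(2 - ε)) < min βs₂ βsI := by
    have h := hu.const_mul (C₄ * |K_h|)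
    rw [mul_zero] at h
    exact h.eventually_lt_const (lt_min hβs₂ hβsI)
  have e5 : ∀ᶠ L : ℕ in atTop, K * (C₄ * |K_h| * (L : ℝ) ^ (-(2 - ε))) < 1 / 2 := by
    have h := (hu.const_mul (C₄ * |K_h|)).const_mul K
    rw [mul_zero, mul_zero] at h
    exact h.eventually_lt_const one_half_pos
  have e6 : ∀ᶠ L : ℕ in atTop,
      2 * K * (C₄ * |K_h|) * K_S * (L : ℝ) ^ (-(2 - ε)) +
        |C₂| * (C₄ * |K_h|) * ((L : ℝ) ^ (-c) + C₄ * |K_h| * (L : ℝ) ^ (-(2 - ε)) + |η L|) < K_S := by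
    have h := (hu.const_mul (2 * K * (C₄ * |K_h|) * K_S)).add
      (((hv.add (hu.const_mul (C₄ * |K_h|))).add hηabs).const_mul (|C₂| * (C₄ * |K_h|)))
    simp only [mul_zero, add_zero] at h
    exact h.eventually_lt_const hKS
  obtain ⟨N, hN⟩ := Filter.eventually_atTop.1 (((e1.and e2).and e3).and (e5.and e6))
  -- the threshold
  refine ⟨max N (max L₁ (max L₀S (max L₀₂ (max L₀I (max L₀₉ 1))))), ?_⟩
  -- the per-`L` statement
  have hper : ∀ L : ℕ, max N (max L₁ (max L₀S (max L₀₂ (max L₀I (max L₀₉ 1))))) ≤ L →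
      ∃ lamL : ℝ,
        |lamL - 1| ≤ 2 * K * (C₄ * |K_h|) * (L : ℝ) ^ (-(2 - ε)) ∧
        Tendsto (fun x : Site d => G L (zc L) x * euclidNorm x ^ ((d : ℝ) - 2)) cofinite
          (𝓝 (lamL * gaussianAmp d / soVariance d L)) ∧
        ∀ s : ℝ, s < min (min ρ 2) (ρ - ((d : ℝ) - 8) / 2) → ∃ Kc : ℝ, ∀ x : Site d,
          |G L (zc L) x - lamL * gaussianAmp d / (soVariance d L * jnorm x ^ ((d : ℝ) - 2))| ≤
            Kc / jnorm x ^ ((d : ℝ) - 2 + s) := by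
    intro L hL
    simp only [max_le_iff] at hL
    obtain ⟨hLN, hL₁, hLS, hL2, hLI, hL9, hL1⟩ := hL
    obtain ⟨⟨⟨h1, h2⟩, h3⟩, h5, h6⟩ := hN L hLN
    have hmax1 : max 1 |η L| = 1 := max_eq_left h1.le
    have hsmall4 : |K_h| * (L : ℝ) ^ (-(2 - ε)) * max 1 |η L| ≤ βs₄ := by
      rw [hmax1, mul_one]; exact h2.le
    have hsmall2 : C₄ * |K_h| * (L : ℝ) ^ (-(2 - ε)) ≤ βs₂ := h3.le.trans (min_le_left _ _)
    have hsmallI : C₄ * |K_h| * (L : ℝ) ^ (-(2 - ε)) ≤ βsI := h3.le.trans (min_le_right _ _)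
    have H4L : ImpulseAt d L ρ ε K_S K_h (η L) (zc L) (G L) βs₄ C₄ :=
      fun z hsm hH' hz hb hbdd => H4 L ε K_S K_h (η L) (zc L) z (G L) hsm hH' hz hb hbdd
    have H22L : Thm22At d L ρ βs₂ c C₂ := H22 L hL2
    have HEL : EstimatesAt d L ρ K := HE L hL1
    have HIRL : IRAt d L ρ βsI K_I := HIR L hLI
    exact thm1_7_at_level hd hL1 hρ hKS (hGH L hL₁).1 (hGH L hL₁).2 (hS L hLS) hC₄ H4L hsmall4
      h1.le H22L hsmall2 hK HEL h5.le h6.le hKI HIRL hsmallI h24 (HS1 L hL9 hL1)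
  -- the function `λ(L)` by choice
  refine ⟨fun L => if h : max N (max L₁ (max L₀S (max L₀₂ (max L₀I (max L₀₉ 1))))) ≤ L then
      Classical.choose (hper L h) else 1, ⟨2 * K * (C₄ * |K_h|), fun L hL => ?_⟩, fun L hL => ?_⟩
  · simp only [dif_pos hL]
    exact (Classical.choose_spec (hper L hL)).1
  · simp only [dif_pos hL]
    exact (Classical.choose_spec (hper L hL)).2

/-- **The corrected Theorem 1.7 from the two remaining named analysis inputs** — Liu–Slade 2026,
Theorem 2.2 (Gaussian deconvolution, spread-out) and Liu–Slade 2024, Theorem 1.2 (critical case) —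
the infrared bound (2.3) and Proposition 4.1 being the tree's `LiuSlade2026_infraredBound_holds`,
`LiuSlade2026_prop41_holds`, and the `S_1`-asymptotics Part 3. [cite: LiuSlade2026, Theorem 1.7 and §1.3] -/
theorem LiuSlade2026_thm1_7_of_two_facts (h22 : LiuSlade2026_thm22)
    (h24 : LiuSlade2024_thm12_critical) : LiuSlade2026_thm1_7 :=
  LiuSlade2026_thm1_7_of_parts' h22 LiuSlade2026_infraredBound_holds LiuSlade2026_prop41_holds h24

/-- **Sakai's Theorem 1.3 (spread-out) from three named facts**: Liu–Slade's Theorem 2.2,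
Liu–Slade 2024 Thm. 1.2 (critical case), and Sakai's lace expansion with diagrammatic bounds
(`Sakai2007_isingAssumptionH`); Prop. 1.2 (1.10) (`LiuSlade2026_prop12_greenBound_holds`), every
clause of Assumption 1.3 for the Ising family, the infrared bound, Prop. 4.1 and the
`S_1`-asymptotics being theorems of the tree. [cite: Sakai2007, Theorem 1.3 (SO model)]
[cite: LiuSlade2026, Theorem 1.7] -/
theorem Sakai2007_thm13_spreadOut_of_three_analysis_facts (h22 : LiuSlade2026_thm22)
    (h24 : LiuSlade2024_thm12_critical) (h2 : Sakai2007_isingAssumptionH) :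
    Sakai2007_thm13_spreadOut :=
  Sakai2007_thm13_spreadOut_of_three_facts' LiuSlade2026_prop12_greenBound_holds
    (LiuSlade2026_thm1_7_of_two_facts h22 h24) h2

end Literature.Barriers.CriticalPhenomena.SpreadOutIsing

namespace Literature.Barriers.CriticalPhenomena

open SpreadOutIsing Literature.Probability.LatticeModels Literature.Probability.Percolation

/-- **The barrier `LaceExpansionIsingAboveFour` from three named facts** — Liu–Slade 2026,
Theorem 2.2; Liu–Slade 2024, Theorem 1.2 (critical case); Sakai's lace expansion with
diagrammatic bounds (`Sakai2007_isingAssumptionH`, Sakai 2007, Props. 1.1 and 3.1 with Sakai 2022)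
— both bubble bounds being theorems (`NNIsing.bubble_susceptibility_upper_holds`, and Aizenman's
bound for the spread-out model by `bubble_susceptibility_upper_of_aizenmanGraham` with the
random-current proof `aizenmanGraham_inequality_holds` on the range-`L` graph). This refines
`LaceExpansionIsingAboveFour_of_seven_facts` (`LaceExpansionIsingDeconvolutionAssembly.lean`).
[cite: Sakai2007, §1.1 and Theorem 1.3] [cite: LiuSlade2026, Theorem 1.7] [cite: LiuSlade2024, Theorem 1.2] -/
theorem LaceExpansionIsingAboveFour_of_three_facts (h22 : LiuSlade2026_thm22)
    (h24 : LiuSlade2024_thm12_critical) (h₅ : Sakai2007_isingAssumptionH) :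
    LaceExpansionIsingAboveFour :=
  LaceExpansionIsingAboveFour_of_facts NNIsing.bubble_susceptibility_upper_holds
    (SpreadOutIsing.bubble_susceptibility_upper_of_aizenmanGraham fun d L n β =>
      aizenmanGraham_inequality_holds (spreadOutGraph d L) (box d n) β)
    (Sakai2007_thm13_spreadOut_of_three_analysis_facts h22 h24 h₅)

end Literature.Barriers.CriticalPhenomena

end
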